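import Literature.NumberTheory.GaloisCohomology.Howard2004.CasselsTateSkewPairingOfTowerPairingLinearProofs
import Literature.Algebra.Module.ResidueFieldReadingOfBalancedPairingProofs
import HarnessLib

/-!
# Howard 2004: the «tower entry» of the typed print leaf C45.1′ `prop141_casselsTate_skewPairing_atLevel` in the
# `ℤ/p`-READ currency of the tree's local duality — proofs file

Topic `NumberTheory/GaloisCohomology/Howard2004`. THEOREMS ONLY: no definition, no named fact, no instance, no notation,
no `sorry`.  Cell `pub/bsd-print-x9` (seat x10b-p1-w7 g12, brick «C451-TOWER-ENTRY-ZMOD», `--supports stmt-BirchSwinnertonDyer-22642`).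
Composition of `CasselsTateSkewPairingOfTowerPairingLinearProofs` (the entry in the engine's `R`-linear currency, p721455) with
`Literature.Algebra.Module.ResidueFieldReadingOfBalancedPairingProofs` (VALUES: a balanced `ℤ/p`-valued pairing is `ι ∘ P` for an
`R`-bilinear `R/𝔪`-valued `P` with the same kernels, `ι` any non-zero reading of the finite residue field).

WHAT IS PROVED.  **`DVRSetting.skewPairings_display_of_towerZModPairing`** — on a FULL `DVRSetting` (`e_i = i + 1`) with
H.0–H.5, at `(k, n ∈ 𝓝^{(k)}, t + 1 < e_k)`: a bi-additive `R`-BALANCED pairing `Q : H¹_{𝓕(n)}(K, T^{(t)}) × H¹_{𝓕(n)}(K, T^{(0)}) → ℤ/p`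
on the engine's modules `selmerModuleAt` with LEFT kernel `= range H¹(red_{t+1→t})`, RIGHT kernel `= range H¹(red_{t+1→0})`
(`redSelLE`) and `Q(a, red^t b) = -Q(b, red^t a)` yields the FIVE clauses of the typed leaf at `(k, n, t)`, verbatim.  This is
the statement a kernel port of Howard Prop. 1.4.1 / Flach (Morgan–Smith arXiv:2103.08530 §3 on
`E = [0 → T^{(0)} → T^{(t+1)} → T^{(t)} → 0]`, values in `(ℚ/ℤ)[p] = ℤ/p`, `R`-balance by naturality) delivers in the tree's
`ℤ/p^k`-reading currency of local Tate duality (`DualityDatumLocalCupScalarReadingProofs`), with NO residue-field structure on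
the values and NO `R`-linearity beyond balance.  Stated PER `(S, k, n, t)`: a port carried out under the extra standing
guard `¬ p ∣ #𝓞_K^×` of Thm. 1.6.1-as-intended (F-161′) feeds the engine's per-setting slot `HasLevelDecompositionsAt` through
this theorem and `hasLevelDecompositionsAt_of_skewPairings_display` without passing through the ∀-settings leaf.

HONEST FRAMING: `Q` is a HYPOTHESIS; Flach's pairing is not constructed; Prop. 1.4.1, Thm. 1.4.2, C45.1′ and
`thm161_dvrKolyvaginBound` are NOT proved; no summit statement is proved; the Birch–Swinnerton-Dyer conjecture is not proved
by any of this.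
-/

set_option autoImplicit false

noncomputable section
namespace Literature.NumberTheory.GaloisCohomology.Howard2004

open Function NumberField IsDedekindDomain Field
open scoped NumberField ContRepresentation Pointwise
open Literature.NumberTheory.GaloisRepresentations
open Literature.NumberTheory.GaloisRepresentations.DiscreteGaloisModule

namespace DVRSetting

variable {p : ℕ} [Fact p.Prime] {K : Type} [Field K] [NumberField K]
  {R : Type} [CommRing R] [IsDomain R] [IsDiscreteValuationRing R] [Algebra ℤ_[p] R]
  {N : ℕ → Type} [∀ k, AddCommGroup (N k)] [∀ k, TopologicalSpace (N k)]
  [∀ k, DiscreteTopology (N k)] [∀ k, Module R (N k)]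
  {Rk : ℕ → Type} [∀ k, CommRing (Rk k)] [∀ k, IsLocalRing (Rk k)] [∀ k, TopologicalSpace (Rk k)]
  [∀ k, DiscreteTopology (Rk k)] [∀ k, Algebra ℤ_[p] (Rk k)] [∀ k, Algebra R (Rk k)]
  [∀ k, Module (Rk k) (N k)] [∀ k, IsScalarTower R (Rk k) (N k)]
  {Nbar : Type} [AddCommGroup Nbar] [TopologicalSpace Nbar] [DiscreteTopology Nbar]
  [∀ k, Module (Rk k) Nbar]
  {Nq : ℕ → Finset (HeightOneSpectrum (𝓞 K)) → Type} [∀ k n, AddCommGroup (Nq k n)]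
  [∀ k n, TopologicalSpace (Nq k n)] [∀ k n, DiscreteTopology (Nq k n)]
  [∀ k n, Module (Rk k) (Nq k n)] [∀ k n, Module R (Nq k n)]
  [∀ k n, IsScalarTower R (Rk k) (Nq k n)]

/-- **TOWER ENTRY, `ℤ/p`-READ CURRENCY (no residue-field structure on the values).**  On a FULL `DVRSetting` with H.0–H.5,
at `(k, n ∈ 𝓝^{(k)}, t + 1 < e_k)`: a bi-additive `R`-BALANCED pairing
`Q : H¹_{𝓕(n)}(K, T^{(t)}) × H¹_{𝓕(n)}(K, T^{(0)}) → ℤ/p` (`Q(ra, w) = Q(a, rw)`; the engine's modules `selmerModuleAt`), with LEFT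
kernel `= range H¹(red_{t+1→t})`, RIGHT kernel `= range H¹(red_{t+1→0})` (the engine's `redSelLE`) and the skew identity of display
(ii) through `redSelLE (0 ≤ t)` — exactly what a port of Prop. 1.4.1 in the tree's `ℤ/p^k`-reading currency of local duality
delivers on the `𝔪`-torsion level (values in `(ℚ/ℤ)[p] = ℤ/p`) — YIELDS the five clauses of the typed leaf at `(k, n, t)`, verbatim:
read `Q` through any non-zero `ι : R/𝔪 →+ ℤ/p` as `ι ∘ P` with `P` `R`-bilinear `R/𝔪`-valued with the same kernels and skew
(`Literature.Algebra.Module.exists_bilinear_of_balanced_zmod_pairing`, the residue field being finite by H.0's coefficient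
ring), then `skewPairings_display_of_towerSkewPairing_linear`.
[cite: Howard2004HeegnerKolyvagin, Prop. 1.4.1 and Thm. 1.4.2 (proof, displays (i)(ii)) (arXiv:1202.6340 p0008 L83–L142), §1.6 ¶1 (p0011 L33–44)]
[cite: Flach1990, the generalised Cassels–Tate pairing and its kernels] -/
theorem skewPairings_display_of_towerZModPairing (S : DVRSetting p K R N Rk Nbar Nq) (hy : S.SatisfiesH)
    (hfull : ∀ i, S.e i = i + 1) (k : ℕ) (n : Finset (HeightOneSpectrum (𝓞 K)))
    (hn : ↑n ⊆ S.levelPrimes k) (t : ℕ) (ht : t + 1 < S.e k)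
    (Q : ↥(S.selmerModuleAt hy t n) →+ ↥(S.selmerModuleAt hy 0 n) →+ ZMod p)
    (hQ : letI := galoisCohomology.moduleH1 (S.T.ρ t) (S.T.hlin t)
      letI := galoisCohomology.moduleH1 (S.T.ρ 0) (S.T.hlin 0)
      ∀ (r : R) (a : ↥(S.selmerModuleAt hy t n)) (w : ↥(S.selmerModuleAt hy 0 n)), Q (r • a) w = Q a (r • w))
    (hleft : letI := galoisCohomology.moduleH1 (S.T.ρ t) (S.T.hlin t)
      letI := galoisCohomology.moduleH1 (S.T.ρ (t + 1)) (S.T.hlin (t + 1))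
      ∀ a : ↥(S.selmerModuleAt hy t n), (∀ w, Q a w = 0) ↔
        a ∈ LinearMap.range (S.redSelLE hy (Nat.le_succ t) n))
    (hright : letI := galoisCohomology.moduleH1 (S.T.ρ 0) (S.T.hlin 0)
      letI := galoisCohomology.moduleH1 (S.T.ρ (t + 1)) (S.T.hlin (t + 1))
      ∀ w : ↥(S.selmerModuleAt hy 0 n), (∀ a, Q a w = 0) ↔
        w ∈ LinearMap.range (S.redSelLE hy (Nat.zero_le (t + 1)) n))
    (hskew : letI := galoisCohomology.moduleH1 (S.T.ρ t) (S.T.hlin t)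
      letI := galoisCohomology.moduleH1 (S.T.ρ 0) (S.T.hlin 0)
      ∀ a b : ↥(S.selmerModuleAt hy t n),
        Q a (S.redSelLE hy (Nat.zero_le t) n b) = - Q b (S.redSelLE hy (Nat.zero_le t) n a)) :
    ∃ P : ↥((((S.t k).atLevel S.jbar n).cond).selmerGroup ⊓
        (galoisCohomology.scalarMapH1 (S.T.ρ k) (S.T.hlin k) (S.π ^ (t + 1))).ker) →+
      ↥((((S.t k).atLevel S.jbar n).cond).selmerGroup ⊓
        (galoisCohomology.scalarMapH1 (S.T.ρ k) (S.T.hlin k) S.π).ker) →+ (R ⧸ IsLocalRing.maximalIdeal R),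
      (∀ (r : R) (x x' : ↥((((S.t k).atLevel S.jbar n).cond).selmerGroup ⊓
          (galoisCohomology.scalarMapH1 (S.T.ρ k) (S.T.hlin k) (S.π ^ (t + 1))).ker))
          (w : ↥((((S.t k).atLevel S.jbar n).cond).selmerGroup ⊓
            (galoisCohomology.scalarMapH1 (S.T.ρ k) (S.T.hlin k) S.π).ker)),
        (x' : galoisCohomology (S.T.ρ k) 1) =
          galoisCohomology.scalarMapH1 (S.T.ρ k) (S.T.hlin k) r (x : galoisCohomology (S.T.ρ k) 1) →
        P x' w = r • P x w) ∧
      (∀ (r : R) (x : ↥((((S.t k).atLevel S.jbar n).cond).selmerGroup ⊓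
          (galoisCohomology.scalarMapH1 (S.T.ρ k) (S.T.hlin k) (S.π ^ (t + 1))).ker))
          (w w' : ↥((((S.t k).atLevel S.jbar n).cond).selmerGroup ⊓
            (galoisCohomology.scalarMapH1 (S.T.ρ k) (S.T.hlin k) S.π).ker)),
        (w' : galoisCohomology (S.T.ρ k) 1) =
          galoisCohomology.scalarMapH1 (S.T.ρ k) (S.T.hlin k) r (w : galoisCohomology (S.T.ρ k) 1) →
        P x w' = r • P x w) ∧
      (∀ x : ↥((((S.t k).atLevel S.jbar n).cond).selmerGroup ⊓
          (galoisCohomology.scalarMapH1 (S.T.ρ k) (S.T.hlin k) (S.π ^ (t + 1))).ker),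
        (∀ w, P x w = 0) ↔
          ∃ z ∈ (((S.t k).atLevel S.jbar n).cond).selmerGroup,
            galoisCohomology.scalarMapH1 (S.T.ρ k) (S.T.hlin k) (S.π ^ (t + 2)) z = 0 ∧
            (x : galoisCohomology (S.T.ρ k) 1) = galoisCohomology.scalarMapH1 (S.T.ρ k) (S.T.hlin k) S.π z) ∧
      (∀ w : ↥((((S.t k).atLevel S.jbar n).cond).selmerGroup ⊓
          (galoisCohomology.scalarMapH1 (S.T.ρ k) (S.T.hlin k) S.π).ker),
        (∀ x, P x w = 0) ↔
          ∃ z ∈ (((S.t k).atLevel S.jbar n).cond).selmerGroup,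
            galoisCohomology.scalarMapH1 (S.T.ρ k) (S.T.hlin k) (S.π ^ (t + 2)) z = 0 ∧
            (w : galoisCohomology (S.T.ρ k) 1) =
              galoisCohomology.scalarMapH1 (S.T.ρ k) (S.T.hlin k) (S.π ^ (t + 1)) z) ∧
      (∀ (a b : ↥((((S.t k).atLevel S.jbar n).cond).selmerGroup ⊓
          (galoisCohomology.scalarMapH1 (S.T.ρ k) (S.T.hlin k) (S.π ^ (t + 1))).ker))
          (a' b' : ↥((((S.t k).atLevel S.jbar n).cond).selmerGroup ⊓
            (galoisCohomology.scalarMapH1 (S.T.ρ k) (S.T.hlin k) S.π).ker)),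
        (a' : galoisCohomology (S.T.ρ k) 1) =
          galoisCohomology.scalarMapH1 (S.T.ρ k) (S.T.hlin k) (S.π ^ t) (a : galoisCohomology (S.T.ρ k) 1) →
        (b' : galoisCohomology (S.T.ρ k) 1) =
          galoisCohomology.scalarMapH1 (S.T.ρ k) (S.T.hlin k) (S.π ^ t) (b : galoisCohomology (S.T.ρ k) 1) →
        P a b' = - P b a') := by
  letI instT := galoisCohomology.moduleH1 (S.T.ρ t) (S.T.hlin t)
  letI inst0 := galoisCohomology.moduleH1 (S.T.ρ 0) (S.T.hlin 0)
  letI instS := galoisCohomology.moduleH1 (S.T.ρ (t + 1)) (S.T.hlin (t + 1))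
  -- the residue field is finite of characteristic `p` (coefficient ring, `p ∈ 𝔪`)
  haveI : Finite (R ⧸ IsLocalRing.maximalIdeal R) := hy.coeffRing.finite_residueField
  have hp : ((p : ℕ) : R) ∈ IsLocalRing.maximalIdeal R := S.natCast_p_mem_maximalIdeal hy
  obtain ⟨ι, hι⟩ := Literature.Algebra.Module.exists_reading_ne_zero (R := R) hp
  -- `𝔪` kills `H¹_{𝓕(n)}(K, T^{(0)})` (`T^{(0)} = T̄`, `e_0 = 1`)
  have hm1 : IsLocalRing.maximalIdeal R ^ S.e 0 = IsLocalRing.maximalIdeal R := by rw [hfull 0, zero_add, pow_one]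
  have hB : ∀ m ∈ IsLocalRing.maximalIdeal R, ∀ b : ↥(S.selmerModuleAt hy 0 n), m • b = 0 := by
    intro m hm b
    apply Subtype.ext
    rw [Submodule.coe_smul, Submodule.coe_zero]
    exact galoisCohomology.smul_eq_zero_of_forall (S.T.ρ 0) (S.T.hlin 0) m
      (fun y => hy.killed 0 m (by rw [hm1]; exact hm) y) b.1
  obtain ⟨P, -, -, hkl, hkr, hsk, -⟩ :=
    Literature.Algebra.Module.exists_bilinear_of_balanced_zmod_pairing hp ι hι hB Q hQ
  refine S.skewPairings_display_of_towerSkewPairing_linear hy hfull k n hn t ht P ?_ ?_ ?_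
  · intro a
    rw [hkl a]
    exact hleft a
  · intro w
    rw [hkr w]
    exact hright w
  · exact hsk (S.redSelLE hy (Nat.zero_le t) n) hskew

end DVRSetting

end Literature.NumberTheory.GaloisCohomology.Howard2004

end
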